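import Mathlib
import HarnessLib
import Summits.AtomisticToContinuum.FouriersLaw.Theses.JunctionLocality

/-!
# Strategy census, generation 2 (instance LCR) — typed companions (crux `JunctionLocality.ConductanceLowerBound`,
item stmt-AtomisticToContinuum-11749; crux-strategist seat `cstrat-stmt-AtomisticToContinuum-11749-s2`, 2026-08-17)

Companion of `STRATEGY-CENSUS.md` Part II-LCR (= `STRATEGY-CENSUS-s2-LCR.md`).  Like generation 1's
`StrategyCensus.lean` (seat s1), this file only TYPES statements named in the census over existing
declarations and proves the elementary implications the census quotes.  Nothing here is a line: no
`stub_*`, no registered composition; the live skeleton `Lines/ForecastSensitivitySketch.lean` is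
untouched.  (Sibling instances of the same seat publish `StrategyCensusS2.lean` and
`StrategyCensusS2LOBV.lean`; namespaces are disjoint.)

Contents
* §1 `UniformBiasFloor` (census S6: the finite-bias, δ-uniform current floor) and
  `conductanceLowerBound_of_uniformBiasFloor : UniformBiasFloor → ConductanceLowerBound` (proved:
  restrict the two-sided response limit to `𝓝[>] 0` and pass to the limit in `c ≤ J/δ`).
* §2 `EventualMonotoneResponse` (census S9: the weakest monotone-type supplier, `∃ N₀ ∀ N ≥ N₀,
  D_N ≤ D_{N+1}`) and `conductanceLowerBound_of_eventualMonotoneResponse :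
  EventualMonotoneResponse → PositiveConductance → ConductanceLowerBound` (proved).
* §3 Census T6 made a theorem: the energy mode of `pinnedChain` is NOT an interacting ballistic
  mode — the Gibbs state carries zero total current at every size and temperature
  (`gibbs_totalCurrent_eq_zero`, from the tree's `pinnedChain_totalCurrent_gibbsMeasure`), hence the
  "hydrodynamic velocity" `T ↦ J_N^{eq}(T)` is constant and its derivative (the flux-Jacobian
  curvature that powers the Doyon / Ampelogiannis–Doyon projection lower bound) vanishes
  identically (`hydroVelocity_deriv_eq_zero`).
-/

noncomputable section

open MeasureTheory Filter Topology Set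
open Literature.MathematicalPhysics.KineticTheory.HeatConduction

namespace Summit.AtomisticToContinuum.FouriersLaw.Cruxes.ConductanceLowerBound.StrategyCensusS2LCR

open Summit.AtomisticToContinuum.FouriersLaw.Theses.JunctionLocality

/-! ## §1 Strengthening S6: the δ-uniform finite-bias floor -/

/-- **S6 — UNIFORM-BIAS FLOOR** (census Part II-LCR §Strengthen, S6).  In the crux frame
(uniqueness antecedent, steady-state family, `T > 0`): there are `c > 0`, a bias window `δ₀ > 0`
and `N₁` such that for every `N ≥ N₁` and every bias `0 < δ < δ₀` the ACTUAL steady-state total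
current at `(T + δ/2, T − δ/2)` is at least `c·δ`.  Strictly stronger than the crux (uniform in
`δ`, no linear-response limit); its only known handle is the entropy-production identity
`σ_N = J·δ/(T_L T_R) = γ Σ_b T_b I_b` (boundary Fisher informations), and a floor on
`I_0 + I_{N−1}` uniform in `N` is the Fisher-square line's dead stub in nonlinear dress (census
S6/S7). -/
def UniformBiasFloor : Prop :=
  ∀ ω₂ lam β γ : ℝ, 0 < ω₂ → 0 < lam → 0 < β → 0 < γ →
    (∀ (N : ℕ) (T_L T_R : ℝ), 0 < T_L → 0 < T_R → ∀ μ ν : Measure (PhaseSpace N),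
      (pinnedChain ω₂ lam β γ).IsSteadyState N T_L T_R μ →
      (pinnedChain ω₂ lam β γ).IsSteadyState N T_L T_R ν → μ = ν) →
    ∀ μ : (N : ℕ) → ℝ → ℝ → Measure (PhaseSpace N),
      (∀ (N : ℕ) (T_L T_R : ℝ), 0 < T_L → 0 < T_R →
        (pinnedChain ω₂ lam β γ).IsSteadyState N T_L T_R (μ N T_L T_R)) →
      ∀ T : ℝ, 0 < T →
        ∃ c : ℝ, 0 < c ∧ ∃ δ₀ : ℝ, 0 < δ₀ ∧ ∃ N₁ : ℕ, ∀ N : ℕ, N₁ ≤ N →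
          ∀ δ : ℝ, 0 < δ → δ < δ₀ →
            c * δ ≤ (pinnedChain ω₂ lam β γ).totalCurrent (μ N (T + δ / 2) (T - δ / 2))

/-- **`UniformBiasFloor → ConductanceLowerBound`** (census S6: the strengthening implies the crux).
Proof: the response hypothesis gives `J_N(δ)/δ → D N` along `𝓝[≠] 0`, hence along `𝓝[>] 0`;
on `(0, δ₀)` the floor gives `c ≤ J_N(δ)/δ`; pass to the limit. -/
theorem conductanceLowerBound_of_uniformBiasFloor (hU : UniformBiasFloor) :
    ConductanceLowerBound := by
  intro ω₂ lam β γ hω hl hβ hγ huniq μ hμ T hT D hD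
  obtain ⟨c, hc, δ₀, hδ₀, N₁, hfloor⟩ := hU ω₂ lam β γ hω hl hβ hγ huniq μ hμ T hT
  refine ⟨c, hc, N₁, fun N hN => ?_⟩
  have hsub : Ioi (0 : ℝ) ⊆ ({0}ᶜ : Set ℝ) := fun x hx => ne_of_gt hx
  have ht : Tendsto (fun δ : ℝ =>
      (pinnedChain ω₂ lam β γ).totalCurrent (μ N (T + δ / 2) (T - δ / 2)) / δ)
      (𝓝[>] 0) (𝓝 (D N)) := (hD N).mono_left (nhdsWithin_mono 0 hsub)
  refine ge_of_tendsto ht ?_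
  filter_upwards [Ioo_mem_nhdsGT hδ₀] with δ hδ
  exact (le_div_iff₀ hδ.1).mpr (hfloor N hN δ hδ.1 hδ.2)

/-! ## §2 Strengthening S9: EVENTUAL monotonicity of the response sequence -/

/-- **S9 — EVENTUALLY MONOTONE RESPONSE** (census Part II-LCR §Strengthen; the weakest monotone-type
supplier, weaker than generation 1's `StrategyCensus.MonotoneResponse` which asks `N ≥ 2`): in the
crux frame, `∃ N₀ ≥ 2, ∀ N ≥ N₀, D_N ≤ D_{N+1}`.  Not implied by the crux and not implying it
without positivity; with the CLOSED `PositiveConductance` it gives the crux with `c = D_{N₀}`.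
Zero slack (`𝒯_{N+1}/𝒯_N ≥ 1 − 1/N` exactly); numerically true in five anharmonic regimes for
`N ≤ 64/128` (kit j021937, lead c3); no sign principle known (census S2, Part I). -/
def EventualMonotoneResponse : Prop :=
  ∀ ω₂ lam β γ : ℝ, 0 < ω₂ → 0 < lam → 0 < β → 0 < γ →
    (∀ (N : ℕ) (T_L T_R : ℝ), 0 < T_L → 0 < T_R → ∀ μ ν : Measure (PhaseSpace N),
      (pinnedChain ω₂ lam β γ).IsSteadyState N T_L T_R μ →
      (pinnedChain ω₂ lam β γ).IsSteadyState N T_L T_R ν → μ = ν) →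
    ∀ μ : (N : ℕ) → ℝ → ℝ → Measure (PhaseSpace N),
      (∀ (N : ℕ) (T_L T_R : ℝ), 0 < T_L → 0 < T_R →
        (pinnedChain ω₂ lam β γ).IsSteadyState N T_L T_R (μ N T_L T_R)) →
      ∀ T : ℝ, 0 < T → ∀ D : ℕ → ℝ,
        (∀ N : ℕ, Tendsto (fun δ : ℝ =>
          (pinnedChain ω₂ lam β γ).totalCurrent (μ N (T + δ / 2) (T - δ / 2)) / δ)
            (𝓝[≠] 0) (𝓝 (D N))) →
        ∃ N₀ : ℕ, 2 ≤ N₀ ∧ ∀ N : ℕ, N₀ ≤ N → D N ≤ D (N + 1)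

/-- **`EventualMonotoneResponse → PositiveConductance → ConductanceLowerBound`**: `c := D N₀ > 0`
and `D N₀ ≤ D N` for `N ≥ N₀` by induction. -/
theorem conductanceLowerBound_of_eventualMonotoneResponse
    (hM : EventualMonotoneResponse) (hP : PositiveConductance) : ConductanceLowerBound := by
  intro ω₂ lam β γ hω hl hβ hγ huniq μ hμ T hT D hD
  have hpos : ∀ N : ℕ, 2 ≤ N → 0 < D N := hP ω₂ lam β γ hω hl hβ hγ huniq μ hμ T hT D hD
  obtain ⟨N₀, hN₀, hmono⟩ := hM ω₂ lam β γ hω hl hβ hγ huniq μ hμ T hT D hD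
  refine ⟨D N₀, hpos N₀ hN₀, N₀, fun N hN => ?_⟩
  induction N, hN using Nat.le_induction with
  | base => exact le_rfl
  | succ n hn ih => exact ih.trans (hmono n hn)

/-! ## §3 Transfer T6: the energy mode is not an interacting ballistic mode -/

/-- **No persistent current at equilibrium, all sizes and temperatures** (census Part II-LCR, T6):
the total current of the Gibbs state of `pinnedChain` vanishes for every `N` and `T` (momentum
reversal; tree lemma `pinnedChain_totalCurrent_gibbsMeasure`).  In hydrodynamic language the
equilibrium flux `T ↦ J^{eq}_N(T)` of the unique conserved density is identically zero, so the
energy mode has hydrodynamic velocity `v ≡ 0`. -/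
theorem gibbs_totalCurrent_eq_zero (ω₂ lam β γ : ℝ) (N : ℕ) (T : ℝ) :
    (pinnedChain ω₂ lam β γ).totalCurrent ((pinnedChain ω₂ lam β γ).gibbsMeasure N T) = 0 :=
  pinnedChain_totalCurrent_gibbsMeasure ω₂ lam β γ N T

/-- **The flux Jacobian and its curvature vanish identically** (census Part II-LCR, T6): the
derivative in `T` of the equilibrium flux is `0` at every `T` (and so is every higher derivative),
so the Doyon / Ampelogiannis–Doyon hydrodynamic-projection lower bound on the Onsager coefficient,
which is proportional to `(v′)²`, is `0` for this chain: the transfer from the solved "chaotic open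
spin chain" sibling has no teeth here. -/
theorem hydroVelocity_deriv_eq_zero (ω₂ lam β γ : ℝ) (N : ℕ) (T : ℝ) :
    deriv (fun T' : ℝ =>
      (pinnedChain ω₂ lam β γ).totalCurrent ((pinnedChain ω₂ lam β γ).gibbsMeasure N T')) T = 0 := by
  have h : (fun T' : ℝ =>
      (pinnedChain ω₂ lam β γ).totalCurrent ((pinnedChain ω₂ lam β γ).gibbsMeasure N T')) =
      fun _ => (0 : ℝ) := funext fun T' => gibbs_totalCurrent_eq_zero ω₂ lam β γ N T'
  rw [h, deriv_const]

end Summit.AtomisticToContinuum.FouriersLaw.Cruxes.ConductanceLowerBound.StrategyCensusS2LCR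

end
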